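import Literature.MathematicalPhysics.QuantumFieldTheory.WilsonWeakCouplingBounds
import HarnessLib

/-!
# Lemma 16.2 for the exponential chart — crux `FreeEnergyLogCoefficient`, line Sketch, stub `fourProduct`

S. Chatterjee, *The leading term of the Yang–Mills free energy*, J. Funct. Anal. 271 (2016),
arXiv:1602.01222, Lemma 16.2, for the EXPONENTIAL chart of the Lie algebra: for skew-Hermitian
`Y₁, …, Y₄ ∈ M_N(ℂ)` of Frobenius norm `≤ η ≤ 1`,
`|Re tr(1 - e^{Y₁} e^{Y₂} e^{Y₃} e^{Y₄}) - ½ ‖Y₁ + Y₂ + Y₃ + Y₄‖²| ≤ 68 N η³`.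
The proof is the one of the Cayley-chart version
`UnitaryCayley.abs_re_trace_one_sub_cay_prod_sub_le` (`WilsonWeakCouplingBounds`) with `cay`
replaced by `exp` and the Taylor remainder `‖e^Y - 1 - Y - Y²/2‖ ≤ ‖Y‖³ e^{‖Y‖}/6 ≤ ‖Y‖³/2`
(Frobenius norm, `‖Y‖ ≤ 1`): expand the four factors `1 + Tᵢ`,
`Tᵢ = e^{Yᵢ} - 1 = Yᵢ + Yᵢ²/2 + O(η³)`, use `Re tr Yᵢ = 0`,
`½ tr Σ Yᵢ² + tr Σ_{i<j} YᵢYⱼ = ½ tr (ΣYᵢ)² = -½ ‖ΣYᵢ‖²` and `|Re tr M| ≤ N ‖M‖_F`.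
-/

noncomputable section

open scoped Matrix Matrix.Norms.Frobenius Nat
open NormedSpace (exp)
open Matrix (trace)
open Literature.MathematicalPhysics.QuantumFieldTheory
open Literature.MathematicalPhysics.QuantumFieldTheory.UnitaryCayley

namespace Summit.QuantumFields.YangMills.Theorems.FreeEnergyLogCoefficient

variable {N : ℕ}

/-! ### Taylor remainder of the matrix exponential in the Frobenius norm -/

/-- Third-order Taylor remainder of the exponential series in the Frobenius norm (no `‖1‖ = 1`
needed since the tail starts at degree `3`): `‖e^Y - 1 - Y - Y²/2‖ ≤ ‖Y‖³ e^{‖Y‖} / 6`, the tail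
`Σ_{n ≥ 3} Yⁿ/n!` being dominated termwise by `‖Y‖³/6 · Σ_n ‖Y‖ⁿ/n!` as `(n + 3)! ≥ 6 · n!`.
[folklore] -/
theorem norm_exp_sub_one_sub_sub_le (Y : Matrix (Fin N) (Fin N) ℂ) :
    ‖exp Y - 1 - Y - (2 : ℂ)⁻¹ • (Y * Y)‖ ≤ ‖Y‖ ^ 3 * Real.exp ‖Y‖ / 6 := by
  have h1 : HasSum (fun n => (n !⁻¹ : ℂ) • Y ^ n) (exp Y) :=
    NormedSpace.exp_series_hasSum_exp' Y
  have h1' : HasSum (fun n => ((n + 3) !⁻¹ : ℂ) • Y ^ (n + 3))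
      (exp Y - 1 - Y - (2 : ℂ)⁻¹ • (Y * Y)) := by
    have h := (hasSum_nat_add_iff' 3).mpr h1
    simp only [Finset.sum_range_succ, Finset.sum_range_zero, zero_add, Nat.factorial_zero,
      Nat.cast_one, inv_one, one_smul, pow_zero, Nat.factorial_one, pow_one, Nat.factorial_two,
      Nat.cast_ofNat] at h
    rwa [sub_sub, sub_sub, ← add_assoc, ← sq]
  have h2 : HasSum (fun n => ‖Y‖ ^ 3 / 6 * (‖Y‖ ^ n / n !)) (‖Y‖ ^ 3 / 6 * Real.exp ‖Y‖) := by
    rw [Real.exp_eq_exp_ℝ]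
    exact (NormedSpace.expSeries_div_hasSum_exp ‖Y‖).mul_left _
  rw [show ‖Y‖ ^ 3 * Real.exp ‖Y‖ / 6 = ‖Y‖ ^ 3 / 6 * Real.exp ‖Y‖ by ring]
  refine h1'.norm_le_of_bounded h2 fun n => ?_
  have hfac : (6 : ℝ) * n ! ≤ ((n + 3) ! : ℕ) := by
    have h := Nat.le_of_dvd (Nat.factorial_pos _)
      (Nat.factorial_mul_factorial_dvd_factorial_add n 3)
    have h3 : (3 : ℕ) ! = 6 := rfl
    rw [h3] at h
    exact_mod_cast (by linarith : 6 * n ! ≤ (n + 3) !)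
  calc ‖((n + 3) !⁻¹ : ℂ) • Y ^ (n + 3)‖ = ‖Y ^ (n + 3)‖ / ((n + 3) ! : ℕ) := by
        rw [norm_smul, norm_inv, Complex.norm_natCast, div_eq_inv_mul]
    _ ≤ ‖Y‖ ^ (n + 3) / ((n + 3) ! : ℕ) := by
        gcongr
        exact norm_pow_le' _ (Nat.succ_pos _)
    _ ≤ ‖Y‖ ^ (n + 3) / (6 * n !) :=
        div_le_div_of_nonneg_left (by positivity) (by positivity) hfac
    _ = ‖Y‖ ^ 3 / 6 * (‖Y‖ ^ n / n !) := by ring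

/-- For `‖Y‖_F ≤ 1`: `‖e^Y - 1 - Y - Y²/2‖ ≤ ‖Y‖³/2` (as `e ≤ 3`).
[cite: arXiv160201222, Lemma 16.1 (analogue)] -/
theorem norm_exp_sub_one_sub_le {Y : Matrix (Fin N) (Fin N) ℂ} (hY : ‖Y‖ ≤ 1) :
    ‖exp Y - 1 - Y - (2 : ℂ)⁻¹ • (Y * Y)‖ ≤ ‖Y‖ ^ 3 / 2 := by
  refine (norm_exp_sub_one_sub_sub_le Y).trans ?_
  have he : Real.exp ‖Y‖ ≤ 3 := (Real.exp_le_exp.2 hY).trans Real.exp_one_lt_three.le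
  have h0 : 0 ≤ ‖Y‖ ^ 3 := by positivity
  nlinarith

/-- `‖e^Y - 1 - Y‖ ≤ ‖Y‖²/2 + ‖Y‖³/2` for `‖Y‖_F ≤ 1`.
[cite: arXiv160201222, Lemma 16.1 (analogue)] -/
theorem norm_exp_sub_one_sub_self_le {Y : Matrix (Fin N) (Fin N) ℂ} (hY : ‖Y‖ ≤ 1) :
    ‖exp Y - 1 - Y‖ ≤ ‖Y‖ ^ 2 / 2 + ‖Y‖ ^ 3 / 2 := by
  have h := norm_exp_sub_one_sub_le hY
  have h2 : ‖(2 : ℂ)⁻¹ • (Y * Y)‖ ≤ ‖Y‖ ^ 2 / 2 := by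
    rw [norm_smul]
    have : ‖(2 : ℂ)⁻¹‖ = 2⁻¹ := by simp
    rw [this]
    have := Matrix.frobenius_norm_mul Y Y
    nlinarith [norm_nonneg (Y * Y)]
  calc ‖exp Y - 1 - Y‖ = ‖(exp Y - 1 - Y - (2 : ℂ)⁻¹ • (Y * Y)) + (2 : ℂ)⁻¹ • (Y * Y)‖ := by
        rw [sub_add_cancel]
    _ ≤ ‖Y‖ ^ 3 / 2 + ‖Y‖ ^ 2 / 2 := (norm_add_le _ _).trans (add_le_add h h2)
    _ = _ := by ring

/-- `‖e^Y - 1‖ ≤ ‖Y‖ + ‖Y‖²/2 + ‖Y‖³/2` for `‖Y‖_F ≤ 1`.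
[cite: arXiv160201222, Lemma 16.1 (analogue)] -/
theorem norm_exp_sub_one_le {Y : Matrix (Fin N) (Fin N) ℂ} (hY : ‖Y‖ ≤ 1) :
    ‖exp Y - 1‖ ≤ ‖Y‖ + ‖Y‖ ^ 2 / 2 + ‖Y‖ ^ 3 / 2 := by
  have h := norm_exp_sub_one_sub_self_le hY
  calc ‖exp Y - 1‖ = ‖(exp Y - 1 - Y) + Y‖ := by rw [sub_add_cancel]
    _ ≤ (‖Y‖ ^ 2 / 2 + ‖Y‖ ^ 3 / 2) + ‖Y‖ := (norm_add_le _ _).trans (add_le_add h le_rfl)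
    _ = _ := by ring

/-! ### Lemma 16.2 for the exponential chart -/

/-- **Lemma 16.2 (exponential chart)**: for skew-Hermitian `Y₁, …, Y₄` of Frobenius norm
`≤ η ≤ 1`, `|Re tr(1 - e^{Y₁} e^{Y₂} e^{Y₃} e^{Y₄}) - ½ ‖Y₁ + Y₂ + Y₃ + Y₄‖²| ≤ 68 N η³` (expand
the four factors `1 + Tᵢ`, `Tᵢ = Yᵢ + Yᵢ²/2 + O(η³)`, use `Re tr Yᵢ = 0` and
`½ tr Σ Yᵢ² + tr Σ_{i<j} YᵢYⱼ = ½ tr (ΣYᵢ)²`). [cite: arXiv160201222, Lemma 16.2] -/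
theorem abs_re_trace_one_sub_exp_prod_sub_le {Y₁ Y₂ Y₃ Y₄ : Matrix (Fin N) (Fin N) ℂ}
    (h₁ : Y₁ᴴ = -Y₁) (h₂ : Y₂ᴴ = -Y₂) (h₃ : Y₃ᴴ = -Y₃) (h₄ : Y₄ᴴ = -Y₄) {η : ℝ} (hη : η ≤ 1)
    (hY₁ : ‖Y₁‖ ≤ η) (hY₂ : ‖Y₂‖ ≤ η) (hY₃ : ‖Y₃‖ ≤ η) (hY₄ : ‖Y₄‖ ≤ η) :
    |(trace (1 - exp Y₁ * exp Y₂ * exp Y₃ * exp Y₄)).re - ‖Y₁ + Y₂ + Y₃ + Y₄‖ ^ 2 / 2| ≤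
      68 * N * η ^ 3 := by
  have hη0 : 0 ≤ η := (norm_nonneg _).trans hY₁
  -- `Tᵢ = exp Yᵢ - 1`
  set T₁ := exp Y₁ - 1 with hT₁
  set T₂ := exp Y₂ - 1 with hT₂
  set T₃ := exp Y₃ - 1 with hT₃
  set T₄ := exp Y₄ - 1 with hT₄
  -- bounds on `Tᵢ` and `Tᵢ - Yᵢ`
  have hT : ∀ {Y : Matrix (Fin N) (Fin N) ℂ}, ‖Y‖ ≤ η → ‖exp Y - 1‖ ≤ 2 * η :=
      fun {Y} hYη => by
    have h := norm_exp_sub_one_le (hYη.trans hη)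
    have : ‖Y‖ ^ 2 ≤ η * ‖Y‖ := by nlinarith [norm_nonneg Y]
    have : ‖Y‖ ^ 3 ≤ η * ‖Y‖ := by nlinarith [norm_nonneg Y]
    nlinarith [norm_nonneg Y]
  have hTY : ∀ {Y : Matrix (Fin N) (Fin N) ℂ}, ‖Y‖ ≤ η → ‖exp Y - 1 - Y‖ ≤ η ^ 2 :=
      fun {Y} hYη => by
    have h := norm_exp_sub_one_sub_self_le (hYη.trans hη)
    have h2 : ‖Y‖ ^ 2 ≤ η ^ 2 := pow_le_pow_left₀ (norm_nonneg _) hYη 2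
    have h3 : ‖Y‖ ^ 3 ≤ η ^ 2 := by
      calc ‖Y‖ ^ 3 = ‖Y‖ ^ 2 * ‖Y‖ := by ring
        _ ≤ η ^ 2 * 1 := mul_le_mul h2 (hYη.trans hη) (norm_nonneg _) (sq_nonneg _)
        _ = η ^ 2 := mul_one _
    nlinarith
  have hR : ∀ {Y : Matrix (Fin N) (Fin N) ℂ}, Yᴴ = -Y → ‖Y‖ ≤ η →
      |(trace (exp Y - 1)).re - (trace (Y * Y)).re / 2| ≤ N * η ^ 3 / 2 := fun {Y} hY hYη => by
    have h := norm_exp_sub_one_sub_le (hYη.trans hη)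
    have e : (trace (exp Y - 1)).re - (trace (Y * Y)).re / 2 =
        (trace (exp Y - 1 - Y - (2 : ℂ)⁻¹ • (Y * Y))).re := by
      simp only [Matrix.trace_sub, Matrix.trace_smul, Complex.sub_re, smul_eq_mul,
        re_trace_eq_zero_of_skew hY]
      norm_num; ring
    rw [e]
    refine (abs_re_trace_le _).trans ?_
    have h3 : ‖Y‖ ^ 3 ≤ η ^ 3 := pow_le_pow_left₀ (norm_nonneg _) hYη 3
    nlinarith [norm_nonneg (exp Y - 1 - Y - (2 : ℂ)⁻¹ • (Y * Y)), Nat.cast_nonneg (α := ℝ) N]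
  -- products
  have hP : ∀ {A B Ya Yb : Matrix (Fin N) (Fin N) ℂ}, ‖A‖ ≤ 2 * η → ‖A - Ya‖ ≤ η ^ 2 →
      ‖Ya‖ ≤ η → ‖B‖ ≤ 2 * η → ‖B - Yb‖ ≤ η ^ 2 →
      |(trace (A * B)).re - (trace (Ya * Yb)).re| ≤ 3 * N * η ^ 3 := by
    intro A B Ya Yb hA hAY hYa hB hBY
    have e : (trace (A * B)).re - (trace (Ya * Yb)).re =
        (trace ((A - Ya) * B + Ya * (B - Yb))).re := by
      rw [← Complex.sub_re, ← Matrix.trace_sub]; congr 2; noncomm_ring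
    rw [e]
    refine (abs_re_trace_le _).trans ?_
    have h1 : ‖(A - Ya) * B + Ya * (B - Yb)‖ ≤ η ^ 2 * (2 * η) + η * η ^ 2 :=
      (norm_add_le _ _).trans (add_le_add
        ((Matrix.frobenius_norm_mul _ _).trans (mul_le_mul hAY hB (norm_nonneg _) (sq_nonneg _)))
        ((Matrix.frobenius_norm_mul _ _).trans (mul_le_mul hYa hBY (norm_nonneg _) hη0)))
    have hN : (0 : ℝ) ≤ N := Nat.cast_nonneg N
    nlinarith
  have hC3 : ∀ {A B C : Matrix (Fin N) (Fin N) ℂ}, ‖A‖ ≤ 2 * η → ‖B‖ ≤ 2 * η → ‖C‖ ≤ 2 * η →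
      |(trace (A * B * C)).re| ≤ 8 * N * η ^ 3 := by
    intro A B C hA hB hC
    refine (abs_re_trace_le _).trans ?_
    have h1 : ‖A * B * C‖ ≤ 2 * η * (2 * η) * (2 * η) :=
      (Matrix.frobenius_norm_mul _ _).trans (mul_le_mul ((Matrix.frobenius_norm_mul _ _).trans
        (mul_le_mul hA hB (norm_nonneg _) (by linarith))) hC (norm_nonneg _) (by positivity))
    have hN : (0 : ℝ) ≤ N := Nat.cast_nonneg N
    nlinarith
  have hC4 : ∀ {A B C D : Matrix (Fin N) (Fin N) ℂ}, ‖A‖ ≤ 2 * η → ‖B‖ ≤ 2 * η →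
      ‖C‖ ≤ 2 * η → ‖D‖ ≤ 2 * η → |(trace (A * B * C * D)).re| ≤ 16 * N * η ^ 3 := by
    intro A B C D hA hB hC hD
    refine (abs_re_trace_le _).trans ?_
    have h1 : ‖A * B * C * D‖ ≤ 2 * η * (2 * η) * (2 * η) * (2 * η) :=
      (Matrix.frobenius_norm_mul _ _).trans (mul_le_mul
        ((Matrix.frobenius_norm_mul _ _).trans (mul_le_mul ((Matrix.frobenius_norm_mul _ _).trans
          (mul_le_mul hA hB (norm_nonneg _) (by linarith))) hC (norm_nonneg _) (by positivity)))
        hD (norm_nonneg _) (by positivity))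
    have hN : (0 : ℝ) ≤ N := Nat.cast_nonneg N
    have hη4 : η ^ 4 ≤ η ^ 3 := by
      calc η ^ 4 = η ^ 3 * η := by ring
        _ ≤ η ^ 3 * 1 := by gcongr
        _ = η ^ 3 := mul_one _
    nlinarith
  -- the expansion
  have hW : exp Y₁ * exp Y₂ * exp Y₃ * exp Y₄ = (1 + T₁) * (1 + T₂) * (1 + T₃) * (1 + T₄) := by
    simp [hT₁, hT₂, hT₃, hT₄]
  rw [hW, expand_four]
  have e1 : ∀ L P Q : Matrix (Fin N) (Fin N) ℂ,
      (1 : Matrix (Fin N) (Fin N) ℂ) - (1 + L + P + Q) = -(L + P + Q) := fun L P Q => by abel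
  rw [e1]
  -- the quadratic main term
  have hZ : (Y₁ + Y₂ + Y₃ + Y₄)ᴴ = -(Y₁ + Y₂ + Y₃ + Y₄) := by
    simp only [Matrix.conjTranspose_add, h₁, h₂, h₃, h₄]; abel
  have hmain : ‖Y₁ + Y₂ + Y₃ + Y₄‖ ^ 2 / 2 =
      -((trace (Y₁ * Y₁)).re + (trace (Y₂ * Y₂)).re + (trace (Y₃ * Y₃)).re +
          (trace (Y₄ * Y₄)).re) / 2 -
        ((trace (Y₁ * Y₂)).re + (trace (Y₁ * Y₃)).re + (trace (Y₁ * Y₄)).re +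
          (trace (Y₂ * Y₃)).re + (trace (Y₂ * Y₄)).re + (trace (Y₃ * Y₄)).re) := by
    rw [← neg_re_trace_sq_of_skew hZ]
    have e : (Y₁ + Y₂ + Y₃ + Y₄) * (Y₁ + Y₂ + Y₃ + Y₄) =
        (Y₁ * Y₁ + Y₂ * Y₂ + Y₃ * Y₃ + Y₄ * Y₄) + (Y₁ * Y₂ + Y₂ * Y₁) + (Y₁ * Y₃ + Y₃ * Y₁) +
          (Y₁ * Y₄ + Y₄ * Y₁) + (Y₂ * Y₃ + Y₃ * Y₂) + (Y₂ * Y₄ + Y₄ * Y₂) +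
            (Y₃ * Y₄ + Y₄ * Y₃) := by
      noncomm_ring
    rw [e]
    simp only [Matrix.trace_add, Complex.add_re, Matrix.trace_mul_comm Y₂ Y₁,
      Matrix.trace_mul_comm Y₃ Y₁, Matrix.trace_mul_comm Y₄ Y₁, Matrix.trace_mul_comm Y₃ Y₂,
      Matrix.trace_mul_comm Y₄ Y₂, Matrix.trace_mul_comm Y₄ Y₃]
    ring
  rw [hmain]
  simp only [Matrix.trace_neg, Matrix.trace_add, Complex.neg_re, Complex.add_re]
  -- the fifteen elementary bounds
  have bT₁ := hT hY₁; have bT₂ := hT hY₂; have bT₃ := hT hY₃; have bT₄ := hT hY₄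
  have dT₁ := hTY hY₁; have dT₂ := hTY hY₂; have dT₃ := hTY hY₃; have dT₄ := hTY hY₄
  have r₁ := abs_le.1 (hR h₁ hY₁); have r₂ := abs_le.1 (hR h₂ hY₂)
  have r₃ := abs_le.1 (hR h₃ hY₃); have r₄ := abs_le.1 (hR h₄ hY₄)
  have p₁₂ := abs_le.1 (hP bT₁ dT₁ hY₁ bT₂ dT₂); have p₁₃ := abs_le.1 (hP bT₁ dT₁ hY₁ bT₃ dT₃)
  have p₁₄ := abs_le.1 (hP bT₁ dT₁ hY₁ bT₄ dT₄); have p₂₃ := abs_le.1 (hP bT₂ dT₂ hY₂ bT₃ dT₃)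
  have p₂₄ := abs_le.1 (hP bT₂ dT₂ hY₂ bT₄ dT₄); have p₃₄ := abs_le.1 (hP bT₃ dT₃ hY₃ bT₄ dT₄)
  have c₁₂₃ := abs_le.1 (hC3 bT₁ bT₂ bT₃); have c₁₂₄ := abs_le.1 (hC3 bT₁ bT₂ bT₄)
  have c₁₃₄ := abs_le.1 (hC3 bT₁ bT₃ bT₄); have c₂₃₄ := abs_le.1 (hC3 bT₂ bT₃ bT₄)
  have c₁₂₃₄ := abs_le.1 (hC4 bT₁ bT₂ bT₃ bT₄)
  simp only [hT₁, hT₂, hT₃, hT₄]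
  refine abs_le.2 ⟨?_, ?_⟩ <;> linarith [r₁.1, r₁.2, r₂.1, r₂.2, r₃.1, r₃.2, r₄.1, r₄.2,
    p₁₂.1, p₁₂.2, p₁₃.1, p₁₃.2, p₁₄.1, p₁₄.2, p₂₃.1, p₂₃.2, p₂₄.1, p₂₄.2, p₃₄.1, p₃₄.2,
    c₁₂₃.1, c₁₂₃.2, c₁₂₄.1, c₁₂₄.2, c₁₃₄.1, c₁₃₄.2, c₂₃₄.1, c₂₃₄.2, c₁₂₃₄.1, c₁₂₃₄.2]

/-- **STUB `fourProduct` — Lemma 16.2 for the exponential chart** (registered signature): there is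
a universal constant `A₀ ≥ 0` (here `A₀ = 68`) such that for skew-Hermitian `Y₁, …, Y₄ ∈ M_N(ℂ)`
of Frobenius norm `≤ η ≤ 1`,
`|Re tr(1 - e^{Y₁} e^{Y₂} e^{Y₃} e^{Y₄}) - ½ ‖Y₁ + Y₂ + Y₃ + Y₄‖²| ≤ A₀ N η³`.
[cite: arXiv160201222, Lemma 16.2] -/
theorem stub_fourProduct : ∃ A₀ : ℝ, 0 ≤ A₀ ∧ ∀ {N : ℕ} (Y₁ Y₂ Y₃ Y₄ : Matrix (Fin N) (Fin N) ℂ),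
    Y₁ᴴ = -Y₁ → Y₂ᴴ = -Y₂ → Y₃ᴴ = -Y₃ → Y₄ᴴ = -Y₄ → ∀ η : ℝ, η ≤ 1 →
    ‖Y₁‖ ≤ η → ‖Y₂‖ ≤ η → ‖Y₃‖ ≤ η → ‖Y₄‖ ≤ η →
    |((1 - NormedSpace.exp Y₁ * NormedSpace.exp Y₂ * NormedSpace.exp Y₃ * NormedSpace.exp Y₄).trace).re -
        ‖Y₁ + Y₂ + Y₃ + Y₄‖ ^ 2 / 2| ≤ A₀ * N * η ^ 3 :=
  ⟨68, by norm_num, fun _ _ _ _ h₁ h₂ h₃ h₄ _ hη hY₁ hY₂ hY₃ hY₄ =>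
    abs_re_trace_one_sub_exp_prod_sub_le h₁ h₂ h₃ h₄ hη hY₁ hY₂ hY₃ hY₄⟩

end Summit.QuantumFields.YangMills.Theorems.FreeEnergyLogCoefficient

end
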